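import Summits.AtomisticToContinuum.FouriersLaw.Theorems.CoercivePulseLinearCeilingIffAbelCeiling
import Summits.AtomisticToContinuum.FouriersLaw.Theorems.EmbeddedDrudeMourreAbelOfSpectralDensity
import Summits.AtomisticToContinuum.FouriersLaw.Theorems.EmbeddedDrudeMourreGreenKuboContinuationFilterInvariance
import HarnessLib

/-!
# `CoercivePulse.LinearCeiling` ⇔ linear small-ball mass of the current spectral measure at zero frequency

Line `SpikeLemma` of crux `CoercivePulse.LinearCeiling` (item stmt-AtomisticToContinuum-15383), lead c2, 2026-08-18:
the CANONICAL SPECTRAL FORM of the crux over landed theorems only. By `linearCeiling_iff_abelCeiling` (p172207) the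
crux is the infinite-volume Abel ceiling (AC) of the summed current autocorrelation `C_T`; by the cosine-Bochner
representation `C_T(t) = ∫ cos(ωt) dσ(ω)` of every guarded pair (`stub_spectralRepresentation`) and Fubini
(`∫₀^∞ e^{−νt} C_T = ∫ ν/(ν²+ω²) dσ`, `AbelOfSpectralDensity.integral_exp_neg_mul_cosTransform`) it is a statement about
ONE finite measure per `(ω₂, lam, β, T)`, the current spectral measure `σ`, and here it is shown EQUIVALENT to

  (SC) `∃ K ε₀ > 0, ∀ ε ∈ (0, ε₀), σ[−ε, ε] ≤ K·ε` — linear small-ball mass at zero frequency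

(no atom at `0` AND bounded lower density of the current power spectrum at `ω = 0`, in the weakest averaged sense):

* (AC) ⇒ (SC) (`measureReal_Icc_le_of_abelMean_le`): the Poisson kernel is `≥ 1/(2ν)` on `|ω| ≤ ν`, so
  `σ[−ν, ν] ≤ 2ν·∫ν/(ν²+ω²)dσ ≤ 2Bν`;
* (SC) ⇒ (AC) (`integral_poisson_le_of_smallBall`): a local linear small-ball bound is a global one
  (`K' = max K (σ(ℝ)/ε₀)`), and the DYADIC DOMINATION of the Poisson kernel
  `ν/(ν²+ω²) ≤ Σ_{k ≤ N} (4/(4^k ν))·1_{[−2^kν, 2^kν]}(ω)` on `|ω| ≤ 2^N ν` (`poisson_le_dyadicSum`, induction on `N`),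
  `≤ 1` beyond (for `2^N ν ≥ 1`, `ν ≤ 1`), integrates to `∫ ν/(ν²+ω²) dσ ≤ 4K'Σ_k 2^{−k} + σ(ℝ) ≤ 8K' + σ(ℝ)`.

So `LinearCeiling ↔ (SC for every cosine-Bochner spectral measure of every guarded pair)`
(`linearCeiling_iff_spectralCeiling`): the crux is EXACTLY "the power spectrum of the total energy current of the
infinite pinned anharmonic chain has `O(ε)` mass in `[−ε, ε]`" — finite conductivity in its weakest (`limsup`) form.
Any zero-frequency limiting-absorption / Mourre bound, or any `L^∞` bound on the spectral density near `0` (no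
continuity needed, cf. the window supplier `linearCeiling_of_windowDecomposition_of_noDrudeWeight`, p172217), supplies (SC).

[cite: BonettoLebowitzReyBellet2000, §7 eq. (37)] [cite: Helfand1960, §II] [cite: Widder1941, Ch. V §1]
-/

noncomputable section

namespace Summit.AtomisticToContinuum.FouriersLaw.Theorems.LinearCeiling.SpikeLemma

open MeasureTheory Filter Set
open scoped Topology BigOperators
open Literature.MathematicalPhysics.KineticTheory.HeatConduction
open Summit.AtomisticToContinuum.FouriersLaw.Theses.CoercivePulse (LinearCeiling)
open Summit.AtomisticToContinuum.FouriersLaw.Theorems.GreenKuboContinuation.BandLimitedKrylov.FilterInvariance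
  (integrable_poisson)

/-! ### (AC) ⇒ (SC): the Poisson kernel bounds box indicators from above -/

/-- **Small-ball bound from one Abel mean.** If `C(t) = ∫ cos(ωt) dσ(ω)` for a finite measure `σ` on `ℝ` and the
Abel mean at `ν > 0` satisfies `∫₀^∞ e^{−νt} C(t) dt ≤ B`, then `σ[−ν, ν] ≤ 2B·ν`: by Fubini the Abel mean is the
Poisson integral `∫ ν/(ν²+ω²) dσ`, and the kernel is `≥ 1/(2ν)` on `|ω| ≤ ν`. [folklore] -/
theorem measureReal_Icc_le_of_abelMean_le (σ : Measure ℝ) [IsFiniteMeasure σ] (C : ℝ → ℝ)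
    (hC : ∀ t : ℝ, C t = ∫ ω, Real.cos (ω * t) ∂σ) {ν B : ℝ} (hν : 0 < ν)
    (hA : ∫ t in Ioi (0:ℝ), Real.exp (-(ν * t)) * C t ≤ B) :
    σ.real (Icc (-ν) ν) ≤ 2 * B * ν := by
  have h1 : ∫ t in Ioi (0:ℝ), Real.exp (-(ν * t)) * C t = ∫ ω, ν / (ν ^ 2 + ω ^ 2) ∂σ := by
    rw [show (fun t => Real.exp (-(ν * t)) * C t) = fun t => Real.exp (-(ν * t)) * ∫ ω, Real.cos (ω * t) ∂σ from
      funext fun t => by rw [hC t]]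
    exact Summit.AtomisticToContinuum.FouriersLaw.Theorems.AbelOfSpectralDensity.integral_exp_neg_mul_cosTransform σ hν
  have h2 : ∫ ω, Set.indicator (Icc (-ν) ν) (fun _ => (2 * ν)⁻¹) ω ∂σ ≤ ∫ ω, ν / (ν ^ 2 + ω ^ 2) ∂σ := by
    refine integral_mono ((integrable_const _).indicator measurableSet_Icc) (integrable_poisson σ hν) fun ω => ?_
    by_cases hω : ω ∈ Icc (-ν) ν
    · rw [Set.indicator_of_mem hω]
      have hden : 0 < ν ^ 2 + ω ^ 2 := by positivity
      have hω2 : ω ^ 2 ≤ ν ^ 2 := by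
        rcases hω with ⟨hlo, hhi⟩
        nlinarith
      rw [show ((2 * ν)⁻¹ : ℝ) = ν / (2 * ν ^ 2) by field_simp]
      exact div_le_div_of_nonneg_left hν.le hden (by nlinarith)
    · rw [Set.indicator_of_notMem hω]
      positivity
  have h3 : ∫ ω, Set.indicator (Icc (-ν) ν) (fun _ => (2 * ν)⁻¹) ω ∂σ = σ.real (Icc (-ν) ν) * (2 * ν)⁻¹ := by
    rw [integral_indicator measurableSet_Icc, setIntegral_const, smul_eq_mul]
  have h4 : σ.real (Icc (-ν) ν) * (2 * ν)⁻¹ ≤ B := by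
    rw [← h3]
    exact h2.trans (h1 ▸ hA)
  rw [← div_eq_mul_inv, div_le_iff₀ (by positivity)] at h4
  linarith

/-! ### (SC) ⇒ (AC): dyadic domination of the Poisson kernel by box indicators -/

/-- **Dyadic domination of the Poisson kernel.** For `ν > 0` and `|ω| ≤ 2^N ν`,
`ν/(ν²+ω²) ≤ Σ_{k=0}^{N} (4/(4^k ν))·1_{[−2^kν, 2^kν]}(ω)`: on the shell `2^{k−1}ν < |ω| ≤ 2^kν` the kernel is
`≤ 1/((1+4^{k−1})ν) ≤ 4/(4^kν)`, the `k`-th term alone. Induction on `N`. [folklore] -/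
theorem poisson_le_dyadicSum {ν : ℝ} (hν : 0 < ν) (N : ℕ) :
    ∀ ω : ℝ, |ω| ≤ 2 ^ N * ν →
      ν / (ν ^ 2 + ω ^ 2) ≤ ∑ k ∈ Finset.range (N + 1),
        4 / (4 ^ k * ν) * Set.indicator (Icc (-(2 ^ k * ν)) (2 ^ k * ν)) (fun _ => (1:ℝ)) ω := by
  induction N with
  | zero =>
    intro ω hω
    have hmem : ω ∈ Icc (-(2 ^ 0 * ν)) (2 ^ 0 * ν) := abs_le.mp hω
    rw [Finset.sum_range_one, Set.indicator_of_mem hmem, mul_one, pow_zero, one_mul]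
    rw [div_le_div_iff₀ (by positivity) hν]
    nlinarith [sq_nonneg ω]
  | succ N ih =>
    intro ω hω
    rw [Finset.sum_range_succ]
    have hnn : ∀ k : ℕ, 0 ≤ 4 / (4 ^ k * ν) * Set.indicator (Icc (-(2 ^ k * ν)) (2 ^ k * ν)) (fun _ => (1:ℝ)) ω :=
      fun k => mul_nonneg (by positivity) (Set.indicator_nonneg (fun _ _ => zero_le_one) _)
    rcases le_or_gt |ω| (2 ^ N * ν) with h | h
    · exact (ih ω h).trans (le_add_of_nonneg_right (hnn (N + 1)))
    · have hmem : ω ∈ Icc (-(2 ^ (N + 1) * ν)) (2 ^ (N + 1) * ν) := abs_le.mp hω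
      rw [Set.indicator_of_mem hmem, mul_one]
      have hsum : 0 ≤ ∑ k ∈ Finset.range (N + 1),
          4 / (4 ^ k * ν) * Set.indicator (Icc (-(2 ^ k * ν)) (2 ^ k * ν)) (fun _ => (1:ℝ)) ω :=
        Finset.sum_nonneg fun k _ => hnn k
      -- on the shell `2^N ν < |ω|` the kernel is at most `4/(4^(N+1) ν) = 1/(4^N ν)`
      have h4N : (4:ℝ) ^ N = (2 ^ N) ^ 2 := by
        rw [← pow_mul, mul_comm, pow_mul]; norm_num
      have hωsq : (2 ^ N * ν) ^ 2 < ω ^ 2 := by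
        have h0 : 0 ≤ 2 ^ N * ν := by positivity
        have h1 : 2 ^ N * ν < |ω| := h
        have := mul_self_lt_mul_self h0 h1
        rw [← sq, ← sq, sq_abs] at this
        exact this
      have hker : ν / (ν ^ 2 + ω ^ 2) ≤ 4 / (4 ^ (N + 1) * ν) := by
        rw [div_le_div_iff₀ (by positivity) (by positivity), pow_succ, h4N]
        nlinarith [sq_nonneg ν, mul_pos hν hν]
      linarith

/-- **Poisson means under a global linear small-ball bound.** If `σ` is a finite measure on `ℝ` with
`σ[−ε, ε] ≤ K·ε` for every `ε > 0`, then `∫ ν/(ν²+ω²) dσ(ω) ≤ 8K + σ(ℝ)` for every `ν ∈ (0, 1]`: dyadic domination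
on `|ω| ≤ 2^N ν` with `2^N ν ≥ 1` (`Σ_{k≤N} (4/(4^kν))·K2^kν = 4KΣ_{k≤N}2^{−k} ≤ 8K`) and the kernel is `≤ 1` beyond.
[folklore] -/
theorem integral_poisson_le_of_smallBall (σ : Measure ℝ) [IsFiniteMeasure σ] {K : ℝ}
    (hsb : ∀ ε : ℝ, 0 < ε → σ.real (Icc (-ε) ε) ≤ K * ε) {ν : ℝ} (hν : 0 < ν) (hν1 : ν ≤ 1) :
    ∫ ω, ν / (ν ^ 2 + ω ^ 2) ∂σ ≤ 8 * K + σ.real univ := by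
  have hK : 0 ≤ K := by
    have h := hsb 1 one_pos
    rw [mul_one] at h
    exact measureReal_nonneg.trans h
  -- a dyadic scale beyond `1/ν`
  obtain ⟨N, hN⟩ : ∃ N : ℕ, ν⁻¹ < 2 ^ N := pow_unbounded_of_one_lt ν⁻¹ one_lt_two
  have h2N : 1 ≤ 2 ^ N * ν := by
    have := (inv_lt_iff_one_lt_mul₀' hν).mp hN
    linarith
  -- the dominating simple function
  set g : ℝ → ℝ := fun ω => ∑ k ∈ Finset.range (N + 1),
    4 / (4 ^ k * ν) * Set.indicator (Icc (-(2 ^ k * ν)) (2 ^ k * ν)) (fun _ => (1:ℝ)) ω with hg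
  have hg0 : ∀ ω, 0 ≤ g ω := fun ω =>
    Finset.sum_nonneg fun k _ => mul_nonneg (by positivity) (Set.indicator_nonneg (fun _ _ => zero_le_one) _)
  have hpt : ∀ ω : ℝ, ν / (ν ^ 2 + ω ^ 2) ≤ g ω + 1 := fun ω => by
    rcases le_or_gt |ω| (2 ^ N * ν) with h | h
    · exact (poisson_le_dyadicSum hν N ω h).trans (le_add_of_nonneg_right zero_le_one)
    · have h1 : 1 < |ω| := lt_of_le_of_lt h2N h
      have hω1 : 1 < ω ^ 2 := by
        have := mul_self_lt_mul_self zero_le_one h1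
        rw [one_mul, ← sq, sq_abs] at this
        exact this
      have hker : ν / (ν ^ 2 + ω ^ 2) ≤ 1 := by
        rw [div_le_one (by positivity)]
        nlinarith [sq_nonneg ν]
      linarith [hg0 ω]
  -- integrability of the dominating function
  have hgi : Integrable g σ := by
    refine integrable_finsetSum _ fun k _ => ?_
    exact ((integrable_const (1:ℝ)).indicator measurableSet_Icc).const_mul _
  have hint : ∫ ω, ν / (ν ^ 2 + ω ^ 2) ∂σ ≤ ∫ ω, (g ω + 1) ∂σ :=
    integral_mono (integrable_poisson σ hν) (hgi.add (integrable_const 1)) hpt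
  -- evaluate the integral of the simple function
  have hval : ∫ ω, (g ω + 1) ∂σ =
      (∑ k ∈ Finset.range (N + 1), 4 / (4 ^ k * ν) * σ.real (Icc (-(2 ^ k * ν)) (2 ^ k * ν))) + σ.real univ := by
    rw [integral_add hgi (integrable_const 1), integral_const, smul_eq_mul, mul_one]
    congr 1
    rw [integral_finsetSum _ fun k _ => ((integrable_const (1:ℝ)).indicator measurableSet_Icc).const_mul _]
    refine Finset.sum_congr rfl fun k _ => ?_
    rw [integral_const_mul, integral_indicator measurableSet_Icc, setIntegral_const, smul_eq_mul, mul_one]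
  -- the small-ball bound on each dyadic box and the geometric sum
  have hbox : ∀ k : ℕ, 4 / (4 ^ k * ν) * σ.real (Icc (-(2 ^ k * ν)) (2 ^ k * ν)) ≤ 4 * K * (1 / 2) ^ k := by
    intro k
    have hk := hsb (2 ^ k * ν) (by positivity)
    have h4k : (4:ℝ) ^ k = 2 ^ k * 2 ^ k := by
      rw [← mul_pow]; norm_num
    calc 4 / (4 ^ k * ν) * σ.real (Icc (-(2 ^ k * ν)) (2 ^ k * ν))
        ≤ 4 / (4 ^ k * ν) * (K * (2 ^ k * ν)) := mul_le_mul_of_nonneg_left hk (by positivity)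
      _ = 4 * K * (1 / 2) ^ k := by
        rw [h4k, one_div, inv_pow]
        field_simp
  have hgeom : ∑ k ∈ Finset.range (N + 1), 4 * K * (1 / 2 : ℝ) ^ k ≤ 8 * K := by
    rw [← Finset.mul_sum]
    have hs : ∑ k ∈ Finset.range (N + 1), (1 / 2 : ℝ) ^ k ≤ 2 := sum_geometric_two_le (N + 1)
    nlinarith
  calc ∫ ω, ν / (ν ^ 2 + ω ^ 2) ∂σ ≤ ∫ ω, (g ω + 1) ∂σ := hint
    _ = (∑ k ∈ Finset.range (N + 1), 4 / (4 ^ k * ν) * σ.real (Icc (-(2 ^ k * ν)) (2 ^ k * ν))) + σ.real univ := hval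
    _ ≤ (∑ k ∈ Finset.range (N + 1), 4 * K * (1 / 2 : ℝ) ^ k) + σ.real univ :=
        add_le_add (Finset.sum_le_sum fun k _ => hbox k) le_rfl
    _ ≤ 8 * K + σ.real univ := by linarith

/-- **Abel means of a cosine transform under a local linear small-ball bound.** If `C(t) = ∫ cos(ωt) dσ(ω)` for a
finite measure `σ` with `σ[−ε, ε] ≤ Kε` for `ε ∈ (0, ε₀)`, then `∫₀^∞ e^{−νt} C(t) dt ≤ 8·max K (σ(ℝ)/ε₀) + σ(ℝ)`
for every `ν ∈ (0, 1)` (the local bound is a global one with constant `max K (σ(ℝ)/ε₀)`). [folklore] -/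
theorem abelMean_le_of_smallBall (σ : Measure ℝ) [IsFiniteMeasure σ] (C : ℝ → ℝ)
    (hC : ∀ t : ℝ, C t = ∫ ω, Real.cos (ω * t) ∂σ) {K ε₀ : ℝ} (hε₀ : 0 < ε₀)
    (hsb : ∀ ε : ℝ, 0 < ε → ε < ε₀ → σ.real (Icc (-ε) ε) ≤ K * ε) {ν : ℝ} (hν : 0 < ν) (hν1 : ν ≤ 1) :
    ∫ t in Ioi (0:ℝ), Real.exp (-(ν * t)) * C t ≤ 8 * max K (σ.real univ / ε₀) + σ.real univ := by
  have h1 : ∫ t in Ioi (0:ℝ), Real.exp (-(ν * t)) * C t = ∫ ω, ν / (ν ^ 2 + ω ^ 2) ∂σ := by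
    rw [show (fun t => Real.exp (-(ν * t)) * C t) = fun t => Real.exp (-(ν * t)) * ∫ ω, Real.cos (ω * t) ∂σ from
      funext fun t => by rw [hC t]]
    exact Summit.AtomisticToContinuum.FouriersLaw.Theorems.AbelOfSpectralDensity.integral_exp_neg_mul_cosTransform σ hν
  rw [h1]
  refine integral_poisson_le_of_smallBall σ (fun ε hε => ?_) hν hν1
  rcases lt_or_ge ε ε₀ with hlt | hge
  · exact (hsb ε hε hlt).trans (mul_le_mul_of_nonneg_right (le_max_left _ _) hε.le)
  · calc σ.real (Icc (-ε) ε) ≤ σ.real univ := measureReal_mono (subset_univ _)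
      _ = σ.real univ / ε₀ * ε₀ := by field_simp
      _ ≤ σ.real univ / ε₀ * ε := mul_le_mul_of_nonneg_left hge (by positivity)
      _ ≤ max K (σ.real univ / ε₀) * ε := mul_le_mul_of_nonneg_right (le_max_right _ _) hε.le

/-! ### The chain: `LinearCeiling` ⇔ spectral small-ball ceiling -/

/-- **(AC) ⇒ (SC).** If the Abel means of `C_T` of every guarded pair of the pinned anharmonic chain are bounded
above on some `(0, ν₀)`, then every cosine-Bochner spectral measure `σ` of `C_T` of every guarded pair has linear
small-ball mass at zero frequency: `σ[−ε, ε] ≤ 2B·ε` for `ε ∈ (0, ν₀)`. [cite: BonettoLebowitzReyBellet2000, §7 eq. (37)] -/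
theorem spectralCeiling_of_abelCeiling
    (hAC : ∀ ω₂ lam β γ : ℝ, 0 < ω₂ → 0 < lam → 0 < β → ∀ T : ℝ, 0 < T →
      ∀ μ : MeasureTheory.Measure ChainConfig, (pinnedChain ω₂ lam β γ).IsChainGibbsMeasure T μ →
      IsShiftInvariant μ → μ.map (fun σ : ChainConfig => fun x : ℤ => ((σ x).1, -(σ x).2)) = μ →
      ∀ D : InfiniteChainDynamics (pinnedChain ω₂ lam β γ), D.PreservesMeasure μ →
      ∃ B ν₀ : ℝ, 0 < ν₀ ∧ ∀ ν : ℝ, 0 < ν → ν < ν₀ →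
        ∫ t in Set.Ioi (0:ℝ), Real.exp (-(ν * t)) * D.currentCorrelation μ t ≤ B) :
    ∀ ω₂ lam β γ : ℝ, 0 < ω₂ → 0 < lam → 0 < β → ∀ T : ℝ, 0 < T →
      ∀ μ : MeasureTheory.Measure ChainConfig, (pinnedChain ω₂ lam β γ).IsChainGibbsMeasure T μ →
      IsShiftInvariant μ → μ.map (fun σ : ChainConfig => fun x : ℤ => ((σ x).1, -(σ x).2)) = μ →
      ∀ D : InfiniteChainDynamics (pinnedChain ω₂ lam β γ), D.PreservesMeasure μ →
      ∀ σ : MeasureTheory.Measure ℝ, MeasureTheory.IsFiniteMeasure σ →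
      (∀ t : ℝ, D.currentCorrelation μ t = ∫ ω, Real.cos (ω * t) ∂σ) →
      ∃ K ε₀ : ℝ, 0 < ε₀ ∧ ∀ ε : ℝ, 0 < ε → ε < ε₀ → σ.real (Set.Icc (-ε) ε) ≤ K * ε := by
  intro ω₂ lam β γ hω hl hβ T hT μ hG hSI hR D hP σ hσ hcos
  obtain ⟨B, ν₀, hν₀, hA⟩ := hAC ω₂ lam β γ hω hl hβ T hT μ hG hSI hR D hP
  refine ⟨2 * B, ν₀, hν₀, fun ε hε hεlt => ?_⟩
  have h := measureReal_Icc_le_of_abelMean_le σ (D.currentCorrelation μ) hcos hε (hA ε hε hεlt)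
  linarith

/-- **(SC) ⇒ (AC).** If every cosine-Bochner spectral measure of `C_T` of every guarded pair of the pinned
anharmonic chain has linear small-ball mass at zero frequency, then the Abel means of `C_T` of every guarded pair
are bounded above on `(0, 1)`: every guarded pair HAS such a spectral measure (`stub_spectralRepresentation`), and
Poisson means are controlled by the small-ball bound (`abelMean_le_of_smallBall`).
[cite: BonettoLebowitzReyBellet2000, §7 eq. (37)] -/
theorem abelCeiling_of_spectralCeiling
    (hSC : ∀ ω₂ lam β γ : ℝ, 0 < ω₂ → 0 < lam → 0 < β → ∀ T : ℝ, 0 < T →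
      ∀ μ : MeasureTheory.Measure ChainConfig, (pinnedChain ω₂ lam β γ).IsChainGibbsMeasure T μ →
      IsShiftInvariant μ → μ.map (fun σ : ChainConfig => fun x : ℤ => ((σ x).1, -(σ x).2)) = μ →
      ∀ D : InfiniteChainDynamics (pinnedChain ω₂ lam β γ), D.PreservesMeasure μ →
      ∀ σ : MeasureTheory.Measure ℝ, MeasureTheory.IsFiniteMeasure σ →
      (∀ t : ℝ, D.currentCorrelation μ t = ∫ ω, Real.cos (ω * t) ∂σ) →
      ∃ K ε₀ : ℝ, 0 < ε₀ ∧ ∀ ε : ℝ, 0 < ε → ε < ε₀ → σ.real (Set.Icc (-ε) ε) ≤ K * ε) :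
    ∀ ω₂ lam β γ : ℝ, 0 < ω₂ → 0 < lam → 0 < β → ∀ T : ℝ, 0 < T →
      ∀ μ : MeasureTheory.Measure ChainConfig, (pinnedChain ω₂ lam β γ).IsChainGibbsMeasure T μ →
      IsShiftInvariant μ → μ.map (fun σ : ChainConfig => fun x : ℤ => ((σ x).1, -(σ x).2)) = μ →
      ∀ D : InfiniteChainDynamics (pinnedChain ω₂ lam β γ), D.PreservesMeasure μ →
      ∃ B ν₀ : ℝ, 0 < ν₀ ∧ ∀ ν : ℝ, 0 < ν → ν < ν₀ →
        ∫ t in Set.Ioi (0:ℝ), Real.exp (-(ν * t)) * D.currentCorrelation μ t ≤ B := by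
  intro ω₂ lam β γ hω hl hβ T hT μ hG hSI hR D hP
  obtain ⟨σ, hσ, hcos⟩ := stub_spectralRepresentation ω₂ lam β γ hω hl hβ T hT μ hG hSI hR D hP
  obtain ⟨K, ε₀, hε₀, hsb⟩ := hSC ω₂ lam β γ hω hl hβ T hT μ hG hSI hR D hP σ hσ hcos
  exact ⟨8 * max K (σ.real univ / ε₀) + σ.real univ, 1, one_pos, fun ν hν hν1 =>
    abelMean_le_of_smallBall σ (D.currentCorrelation μ) hcos hε₀ hsb hν hν1.le⟩

/-- **`LinearCeiling` ⇔ (SC)** — the crux `CoercivePulse.LinearCeiling` (item stmt-AtomisticToContinuum-15383) holds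
iff every cosine-Bochner spectral measure of the summed current autocorrelation of every guarded pair of the pinned
anharmonic chain has LINEAR SMALL-BALL MASS AT ZERO FREQUENCY, `σ[−ε, ε] = O(ε)`: no energy Drude weight and a
bounded lower density of the current power spectrum at `ω = 0` — finite conductivity in its weakest form.
[cite: BonettoLebowitzReyBellet2000, §7 eq. (37)] [cite: Helfand1960, §II] -/
theorem linearCeiling_iff_spectralCeiling :
    LinearCeiling ↔
    (∀ ω₂ lam β γ : ℝ, 0 < ω₂ → 0 < lam → 0 < β → ∀ T : ℝ, 0 < T →
      ∀ μ : MeasureTheory.Measure ChainConfig, (pinnedChain ω₂ lam β γ).IsChainGibbsMeasure T μ →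
      IsShiftInvariant μ → μ.map (fun σ : ChainConfig => fun x : ℤ => ((σ x).1, -(σ x).2)) = μ →
      ∀ D : InfiniteChainDynamics (pinnedChain ω₂ lam β γ), D.PreservesMeasure μ →
      ∀ σ : MeasureTheory.Measure ℝ, MeasureTheory.IsFiniteMeasure σ →
      (∀ t : ℝ, D.currentCorrelation μ t = ∫ ω, Real.cos (ω * t) ∂σ) →
      ∃ K ε₀ : ℝ, 0 < ε₀ ∧ ∀ ε : ℝ, 0 < ε → ε < ε₀ → σ.real (Set.Icc (-ε) ε) ≤ K * ε) :=
  linearCeiling_iff_abelCeiling.trans ⟨spectralCeiling_of_abelCeiling, abelCeiling_of_spectralCeiling⟩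

/-- **(SC) ⇒ `LinearCeiling`** — the weakest spectral supplier of the crux: a linear small-ball bound of the
current spectral measure at zero frequency (e.g. from a zero-frequency limiting-absorption bound, or an `L^∞`
density near `0`) gives the diffusive upper envelope of the Helfand moment. [cite: Helfand1960, §II] -/
theorem linearCeiling_of_spectralCeiling
    (hSC : ∀ ω₂ lam β γ : ℝ, 0 < ω₂ → 0 < lam → 0 < β → ∀ T : ℝ, 0 < T →
      ∀ μ : MeasureTheory.Measure ChainConfig, (pinnedChain ω₂ lam β γ).IsChainGibbsMeasure T μ →
      IsShiftInvariant μ → μ.map (fun σ : ChainConfig => fun x : ℤ => ((σ x).1, -(σ x).2)) = μ →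
      ∀ D : InfiniteChainDynamics (pinnedChain ω₂ lam β γ), D.PreservesMeasure μ →
      ∀ σ : MeasureTheory.Measure ℝ, MeasureTheory.IsFiniteMeasure σ →
      (∀ t : ℝ, D.currentCorrelation μ t = ∫ ω, Real.cos (ω * t) ∂σ) →
      ∃ K ε₀ : ℝ, 0 < ε₀ ∧ ∀ ε : ℝ, 0 < ε → ε < ε₀ → σ.real (Set.Icc (-ε) ε) ≤ K * ε) :
    LinearCeiling :=
  linearCeiling_iff_spectralCeiling.2 hSC

end Summit.AtomisticToContinuum.FouriersLaw.Theorems.LinearCeiling.SpikeLemma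

end
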